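import Literature.Probability.RandomPlanarGeometry.SLEKappaRhoLemma810
import Literature.Probability.RandomPlanarGeometry.SLEKappaRhoSlidArc
import Literature.Probability.RandomPlanarGeometry.SLEKappaRhoBesselEquation
import Literature.Probability.RandomPlanarGeometry.SLERestrictionSmooth
import HarnessLib

/-!
# [LSW] §8.4: the named fact `exists_isOneSidedMartingale` reduces to the martingale extension of Lemma 8.9

G. F. Lawler, O. Schramm, W. Werner, *Conformal restriction: the chordal case*, J. Amer. Math.
Soc. **16** (2003) 917–955, arXiv:math/0209343 (**[LSW]**), §8.4 "Proof of Theorem 8.4":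
Lemma 8.9 ("`(M_t, t < T)` is a local martingale"), Lemma 8.10 ("There exists `ε > 0` such that
`M_t ≤ h_t'(W_t)^ε` for all `t < T`. In particular, `M_t ≤ 1`") with (8.2)
("`h_t'(W_t) ≤ (h_t(W_t) − h_t(O_t))/(W_t − O_t) ≤ h_t'(O_t) ≤ 1`"), and the end of the proof of
Thm. 8.4 ("since `M_t` converges a.s. and in `L¹` when `t → T`").

The named fact `SLEKappaRho.exists_isOneSidedMartingale` (`SLEKappaRhoRestriction`) packages these
three printed items as the structure `SLEKappaRho.IsOneSidedMartingale ρ A W M`. The tree already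
separates them: `SLEKappaRho.IsMartingaleExtension ρ A O W M` (`SLEKappaRhoMartingale`) is the
conclusion of Lemma 8.9 with the convergence clause for the EXPLICIT functional
`M_t = oneSidedM ρ (A_t − W_t) (O_t − W_t)`, and Lemma 8.10 with (8.2) is PROVED for that
functional on arc `+`-hulls (`SLEKappaRho.oneSidedM_bounds_of_isArcHull`, `SLEKappaRhoLemma810`,
with the explicit exponents `ε = min(5/8, α)`, `N = max(5/8, α)`).

This file PROVES the deduction (no new definition, no named fact):

* `SLEKappaRho.IsMartingaleExtension.isOneSidedMartingale` — for `ρ > −2`, an SLE(8/3, ρ)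
  driving pair `(O, W)` and a smooth `A ∈ 𝒬₊`, a martingale extension `M` of the formula has all
  the properties of `IsOneSidedMartingale ρ A W M`: `M_0 = Φ_A'(0)^α` (a.s. the paths of `W` are
  continuous, `IsSLEKappaRhoPair.ae_continuous` with the proved integrated Bessel equation
  `SLEKappaRho.integral_inv_eq_holds`, so `T_A > 0`, the slid hull at time `0` is `A`, and
  `O_0 = W_0 = 0`: `oneSidedM_zero`, "when `W_t = O_t` we take `M_t = h_t'(W_t)^{5/8+b+c}`",
  `5/8 + b + c = α`); and the two-sided bounds `h_t'(W_t)^N ≤ M_t ≤ h_t'(W_t)^ε` before `T_A`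
  (the slid hull of the smooth, hence arc, `+`-hull `A` before `T_A` is an arc `+`-hull,
  `Loewner.isArcHull_slidHull_of_disjoint` / `Loewner.isPlusHull_slidHull_of_disjoint`, and
  `O_t ≤ W_t`, so Lemma 8.10 applies);
* `SLEKappaRho.exists_isOneSidedMartingale_of_extension` (and the variant `…_of_extension'`
  asking for the extension only for NONEMPTY hulls, the empty hull being served by the constant
  `1`, `isMartingaleExtension_empty`) — hence the named fact follows from the existence of a
  martingale extension for every SLE(8/3, ρ) pair and every smooth `A ∈ 𝒬₊`, i.e. from the
  stochastic-calculus content of Lemma 8.9 alone.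

## References

* [LSW] §8.4: Lemma 8.9, Lemma 8.10 with (8.2), end of the proof of Thm. 8.4.
  [LawlerSchrammWerner2003Restriction]
-/

noncomputable section

open Set Filter Topology MeasureTheory
open scoped NNReal ENNReal
open UpperHalfPlane (upperHalfPlaneSet)
open Literature.Probability.Process (preWienerMeasure)

namespace Literature.Probability.RandomPlanarGeometry

namespace SLEKappaRho

variable {ρ : ℝ} {O W M : ℝ≥0 → (ℝ≥0 → ℝ) → ℝ} {A : Set ℂ}

/-- For an SLE(8/3, ρ) pair, a.s. the path `t ↦ W_t(ω)` is continuous (the integrated Bessel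
equation `SLEKappaRho.integral_inv_eq_holds` fed to `IsSLEKappaRhoPair.ae_continuous`).
[cite: LawlerSchrammWerner2003Restriction, §8.3 (definition of SLE(κ, ρ))] -/
theorem ae_continuous_snd (hρ : -2 < ρ) (hOW : IsSLEKappaRhoPair (8 / 3) ρ O W) :
    ∀ᵐ ω ∂preWienerMeasure, Continuous fun t ↦ W t ω := by
  have hκ0 : (0 : ℝ≥0) < 8 / 3 := by positivity
  exact (hOW.ae_continuous integral_inv_eq_holds hκ0 hρ).mono fun ω hω ↦ hω.1

/-- At time `0` the slid hull of a driving function with `W_0 = 0` is the hull itself (for a hull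
off the origin). [folklore] -/
theorem slidHull_zero_of_apply_zero {U : ℝ≥0 → ℝ} (hU : Continuous U) (hU0 : U 0 = 0)
    (hA0 : (0 : ℂ) ∉ A) : Loewner.slidHull U A 0 = A := by
  rw [Loewner.slidHull_zero hU (by rw [hU0, Complex.ofReal_zero]; exact hA0), hU0]
  simp

/-- **Lemma 8.10 with (8.2) along the flow**: before `T_A`, the slid hull `A_t − W_t` of a smooth
`A ∈ 𝒬₊` under a continuous driving function from `0` is an arc `+`-hull, so for `o ≤ 0` the
functional `oneSidedM ρ · o` lies between `Φ'^N` and `Φ'^ε`, `ε = min(5/8, α)`, `N = max(5/8, α)`,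
for its restriction derivative `Φ' = hullDeriv (A_t − W_t) ∈ (0, 1]`, which is the derivative of
some restriction data. [cite: LawlerSchrammWerner2003Restriction, Lemma 8.10 with (8.2)] -/
theorem exists_restrictionData_oneSidedM_bounds (hρ : -2 < ρ) (hAs : IsSmoothHull A)
    (hA : IsPlusHull A) {U : ℝ≥0 → ℝ} (hU : Continuous U) (hU0 : U 0 = 0) {t : ℝ≥0}
    (ht : (t : WithTop ℝ≥0) < Loewner.hullHitTime U A)
    {o : ℝ} (ho : o ≤ 0) :
    ∃ (Ψ : ConformalEquiv (upperHalfPlaneSet \ Loewner.slidHull U A t) upperHalfPlaneSet) (e : ℝ),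
      IsRestrictionMap (Loewner.slidHull U A t) Ψ ∧ HasRestrictionDeriv (Loewner.slidHull U A t) Ψ e ∧
        0 < e ∧ e ≤ 1 ∧ e ^ max (5 / 8 : ℝ) (sleKappaRhoExponent ρ) ≤ oneSidedM ρ (Loewner.slidHull U A t) o ∧
          oneSidedM ρ (Loewner.slidHull U A t) o ≤ e ^ min (5 / 8 : ℝ) (sleKappaRhoExponent ρ) := by
  have hdisj := Loewner.disjoint_closedHull_of_lt_hullHitTime ht
  have hBarc : IsArcHull (Loewner.slidHull U A t) :=
    Loewner.isArcHull_slidHull_of_disjoint hU hAs.isArcHull hA.1.zero_notMem hdisj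
  have hBplus : IsPlusHull (Loewner.slidHull U A t) :=
    Loewner.isPlusHull_slidHull_of_disjoint hU hU0 hA hdisj
  obtain ⟨Ψ, hΨ, hd, hpos, hle⟩ := exists_hasRestrictionDeriv_hullDeriv hBplus.1
  obtain ⟨hlow, hup⟩ := oneSidedM_bounds_of_isArcHull hρ hBarc hBplus ho
  exact ⟨Ψ, hullDeriv _, hΨ, hd, hpos, hle, hlow, hup⟩

namespace IsMartingaleExtension

/-- **A martingale extension of the formula is a one-sided restriction martingale** ([LSW] §8.4:
Lemma 8.9 + Lemma 8.10/(8.2) + the convergence clause give all the properties the end of the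
proof of Thm. 8.4 consumes): for `ρ > −2`, an SLE(8/3, ρ) driving pair `(O, W)` and a smooth
`A ∈ 𝒬₊`, `IsMartingaleExtension ρ A O W M → IsOneSidedMartingale ρ A W M`, with
`ε = min(5/8, α)`, `N = max(5/8, α)`.
[cite: LawlerSchrammWerner2003Restriction, §8.4: Lemma 8.9, Lemma 8.10 with (8.2), end of the proof of Thm. 8.4] -/
theorem isOneSidedMartingale (hρ : -2 < ρ) (hOW : IsSLEKappaRhoPair (8 / 3) ρ O W)
    (hAs : IsSmoothHull A) (hA : IsPlusHull A) (hM : IsMartingaleExtension ρ A O W M) :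
    IsOneSidedMartingale ρ A W M where
  mem_Icc := hM.mem_Icc
  martingale := hM.martingale
  ae_apply_zero := by
    filter_upwards [hM.ae_eq_oneSidedM, ae_continuous_snd hρ hOW] with ω hω hc Φ d hΦ hd
    have hW0 : W 0 ω = 0 := hOW.snd_zero ω
    have hO0 : O 0 ω = 0 := hOW.fst_zero ω
    have hpos : (0 : WithTop ℝ≥0) < Loewner.hullHitTime (fun s ↦ W s ω) A :=
      Loewner.hullHitTime_pos hc hW0 hA.1.isBoundedHull.isClosed hA.1.zero_notMem
    have h := hω 0 (by exact_mod_cast hpos)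
    rw [hO0, hW0, sub_zero, slidHull_zero_of_apply_zero hc hW0 hA.1.zero_notMem, oneSidedM_zero,
      hullDeriv_eq hA.1 hΦ hd] at h
    exact h
  ae_rpow_le_le_rpow := by
    refine ⟨min (5 / 8 : ℝ) (sleKappaRhoExponent ρ), max (5 / 8 : ℝ) (sleKappaRhoExponent ρ),
      lt_min (by norm_num) (sleKappaRhoExponent_pos hρ),
      lt_max_of_lt_left (by norm_num), ?_⟩
    filter_upwards [hM.ae_eq_oneSidedM, ae_continuous_snd hρ hOW] with ω hω hc t ht
    have ho : O t ω - W t ω ≤ 0 := sub_nonpos.2 (hOW.le t ω)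
    obtain ⟨Ψ, e, hΨ, he, hpos, hle, hlow, hup⟩ :=
      exists_restrictionData_oneSidedM_bounds hρ hAs hA hc (hOW.snd_zero ω) ht ho
    refine ⟨Ψ, e, hΨ, he, hpos, hle, ?_, ?_⟩
    · rw [hω t ht]; exact hlow
    · rw [hω t ht]; exact hup
  ae_frozen := hM.ae_frozen
  ae_exists_tendsto := hM.ae_exists_tendsto

end IsMartingaleExtension

/-- **`exists_isOneSidedMartingale` from the existence of martingale extensions** (Lemma 8.9 with
the convergence clause, for every SLE(8/3, ρ) pair and every smooth `A ∈ 𝒬₊`).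
[cite: LawlerSchrammWerner2003Restriction, §8.4: Lemma 8.9, Lemma 8.10, end of the proof of Thm. 8.4] -/
theorem exists_isOneSidedMartingale_of_extension
    (h : ∀ {ρ : ℝ} {O W : ℝ≥0 → (ℝ≥0 → ℝ) → ℝ}, -2 < ρ → IsSLEKappaRhoPair (8 / 3) ρ O W →
      ∀ {A : Set ℂ}, IsSmoothHull A → IsPlusHull A → ∃ M, IsMartingaleExtension ρ A O W M) :
    exists_isOneSidedMartingale := by
  intro ρ O W hρ hOW A hAs hA
  obtain ⟨M, hM⟩ := h hρ hOW hAs hA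
  exact ⟨M, hM.isOneSidedMartingale hρ hOW hAs hA⟩

/-- **`exists_isOneSidedMartingale` from the existence of martingale extensions for NONEMPTY
smooth hulls of `𝒬₊`** (the empty hull: `T_∅ = ∞`, `M ≡ 1`, `isMartingaleExtension_empty`).
[cite: LawlerSchrammWerner2003Restriction, §8.4: Lemma 8.9, Lemma 8.10, end of the proof of Thm. 8.4] -/
theorem exists_isOneSidedMartingale_of_extension'
    (h : ∀ {ρ : ℝ} {O W : ℝ≥0 → (ℝ≥0 → ℝ) → ℝ}, -2 < ρ → IsSLEKappaRhoPair (8 / 3) ρ O W →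
      ∀ {A : Set ℂ}, IsSmoothHull A → IsPlusHull A → A.Nonempty →
        ∃ M, IsMartingaleExtension ρ A O W M) :
    exists_isOneSidedMartingale := by
  refine exists_isOneSidedMartingale_of_extension fun hρ hOW A hAs hA ↦ ?_
  rcases A.eq_empty_or_nonempty with rfl | hne
  · exact ⟨fun _ _ ↦ 1, isMartingaleExtension_empty _ _ _⟩
  · exact h hρ hOW hAs hA hne

end SLEKappaRho

end Literature.Probability.RandomPlanarGeometry

end
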